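/-
Origin: expansion seat `planner-pub-hodgecm-pv01-g3-0`, handover 2026-08-18T05:50:32Z (`HOME/pub-hodgecm-pv01-g3/lean/Pv01g3/Li92Vacuity.lean`, md5 ac391ccc, 318 lines);
landed by the gen-6 packager in gate run 24 as `HodgeCM/PerL34/Li92Vacuity.lean` (verbatim).
-/
/-
pub-hodgecm cell — DAG-NODE PROVER #01 gen 3 (session planner-pub-hodgecm-pv01-g3-0, unit pub-hodgecm-pv01-g3).
`Li92Vacuity`: a BOUNDARY WITNESS for the two DATA binders of the Li92 line (pv13-g2, `Li92Bridge.lean`, run 22) in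
the format of referee A round 15/16 P1 ("junk-instance / STRENGTH test of each DATA binder fed by name, relative to
the open input it feeds") — no mathematics of PerL, nothing posited, nothing cited.  It records, as kernel theorems,
that ROUTE B's record `Li92Route.PrintInputs T` (binder `hP` of the landed `Li92Route.perL_of_li92PrintWeilLeaves`,
`Li92PerL.lean`) and ROUTE A's record `Li92Route.AnalyticInputs T` are LOGICALLY NO STRONGER than the open input
`T.Open_chars` they feed (`open_chars_of_print`, `open_chars_of_analytic`), as soon as each `L²([G_U])` space
`T.HG L ι₁ V` has a nonzero vector — the same non-triviality hypothesis `hNT` as the carver's seam-S3 witness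
`clusterOutputs_iff_open_chars` (`SeamVacuity.lean`).  Given `Open_chars`, an `OccSide` / `AnalyticSide` record is
built from the JUNK DICTIONARY: ambient `act := ∅`, `InA10 := ⊤` (every subspace "lies in `𝒜^{1,0}`"); Li-datum :=
pv13's all-`True` toy `Smoke.liDatum` with PerL's parameters `(3,1,2,1)`, whose verbatim print field
`StableRangeNonvanishing` ([Li92 Cor 5.5]) holds TRIVIALLY (`Smoke.liDatum_cor55`); `Θ(χ) := {θ}`, `V(θ,χ) := ℂ∙θ`
for one unit vector `θ` — a line is an atom of the subspace lattice, hence "irreducible"; (r3) `allowed_of :=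
Open_chars`; (r1a) occurrence `:= trivial`; on route A the carver's junk `LocalFactorDatum` around the same `θ`.
Conversely (hypothesis-free) both records FORCE a nonzero `L²` vector in every good context that carries a character
(`exists_ne_zero_of_printInputs`, `exists_ne_zero_of_analyticInputs`), so `hNT` is the exact price:
`printInputs_iff` / `analyticInputs_iff` state the equivalences with no hypothesis at all.
MEANING (for referees, not an objection): the verbatim print `LineDict.cor55 : G.StableRangeNonvanishing` is
quantified over the FREE record `G : Li92GlobalDatum` (the Literature seat types Li's theorem over carriers that the
consumer must pin), and `Ambient.InA10`, `TorusData.allowed` are opaque predicates; so the by-name closures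
`open_chars_of_print` / `open_chars_of_analytic` carry [Li92 Cor 5.5] (and, on route A, the N31 files) to the model
ONLY through an HONEST instantiation that pins `LineDict.G` to Li's carriers for the dual pairs `(U(V₃), U(W_i))` over
`L₀`, `Ambient.act/InA10` to the right translations and the archimedean-type predicate `𝒜^{1,0}`, `LineDict.Vθ` to
Li's `V(θ,χ'_i)`, and (r3) to Definition 3.2 — the dictionary fields D2/D4/(r1)/(r3) of `Li92Bridge`'s module
docstring.  The typed cone cannot tell an honest instance from this junk one; that distinction lives at the
instantiation boundary (LEMMAS.md §9, FACTS.md §0 "LEAF WIRING IS TYPE-LEVEL"), exactly as for seam S3.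
Imports: the landed `HodgeCM.PerL34.Li92Bridge` (pv13-g2, run 22) and `HodgeCM.PerL34.SeamVacuity` (carver-g2,
run 21).  Proposed place: `HodgeCM/PerL34/Li92Vacuity.lean`; new names live in `HodgeCM.PerL34.Li92Route.Junk` (the
junk dictionary) and in `HodgeCM.PerL34.Li92Route` (the theorems of § Model + the `Prop` `CharsSeeVector`; no clash
with the tree).  EXACT STRENGTH, all three records, no hypothesis: `printInputs_iff`, `analyticInputs_iff`,
`clusterOutputs_iff` : `_ ↔ T.Open_chars ∧ CharsSeeVector T` (for the carver's `ClusterOutputs` the vector is the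
theta lift `(S.fst χ).theta ≠ 0`, N31h (i) `LocalFactorDatum.theta_ne_zero`); hence `ClusterOutputs T ↔
AnalyticInputs T ↔ PrintInputs T` outright.  Sequel: `Li92VacuityLeaves` (this seat) discharges `hNT` /
`CharsSeeVector` from the end-state theorems' own binders.
-/
import Summits.HodgeConjecture.HodgeCM.PerL34.Li92Bridge_2
import Summits.HodgeConjecture.HodgeCM.PerL34.SeamVacuity

set_option autoImplicit false

noncomputable section

namespace HodgeCM
namespace PerL34
namespace Li92Route

open HodgeCM.Prior.Perl34File
open HodgeCM.PerL34.Schur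
open HodgeCM.PerL34.EulerProduct
open HodgeCM.Literature.Theta

/-! ### The junk dictionary over an arbitrary ambient Hilbert space -/

namespace Junk

variable {HG : Type*} [NormedAddCommGroup HG] [InnerProductSpace ℂ HG] [CompleteSpace HG]

/-- The junk ambient: NO operators (`act := ∅`, so every subspace is invariant) and `InA10 := ⊤` (every closed
invariant subspace "is an irreducible automorphic representation in `𝒜^{1,0}`"). -/
def ambient : Ambient HG where
  act := ∅
  InA10 := fun _ => True

omit [CompleteSpace HG] in
/-- A line `ℂ∙θ` is closed. -/
theorem isClosed_span_singleton (θ : HG) : IsClosed ((Submodule.span ℂ ({θ} : Set HG) : Submodule ℂ HG) : Set HG) :=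
  Submodule.closed_of_finiteDimensional _

omit [CompleteSpace HG] in
/-- Hence its closure is itself. -/
theorem closure_span_singleton (θ : HG) :
    (Submodule.span ℂ ({θ} : Set HG)).topologicalClosure = Submodule.span ℂ ({θ} : Set HG) :=
  (isClosed_span_singleton θ).submodule_topologicalClosure_eq

omit [CompleteSpace HG] in
/-- A line through a nonzero vector is an atom: its only subspaces are `⊥` and itself ("irreducible"). -/
theorem eq_bot_or_eq_of_le_span_singleton {θ : HG} (hθ : θ ≠ 0) {K : Submodule ℂ HG}
    (hK : K ≤ Submodule.span ℂ ({θ} : Set HG)) : K = ⊥ ∨ K = Submodule.span ℂ ({θ} : Set HG) :=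
  (nonzero_span_atom θ hθ).le_iff.mp hK

/-- **The junk line dictionary** over ANY character type `X`, around one nonzero vector `θ`: Li-datum := the
all-`True` `Smoke.liDatum` (so `cor55`, `ds_arch`, occurrence, `thetaNe`, `thetaIrr`, `howe` are all `trivial`),
`Θ(χ) := {θ}`, `V(θ,χ) := ℂ∙θ` (closed, an atom), `(r1) := trivial`. -/
def line (X : Type) (θ : HG) (hθ : θ ≠ 0) : LineDict (ambient : Ambient HG) X where
  G := Smoke.liDatum
  cor55 := Smoke.liDatum_cor55
  n_eq := rfl
  n'_eq := rfl
  d_eq := rfl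
  d₀_eq := rfl
  cusp := fun _ => ()
  ds_arch := fun _ _ _ => trivial
  Theta := fun _ => {θ}
  Vθ := fun _ => Submodule.span ℂ ({θ} : Set HG)
  Theta_sub := fun _ => Submodule.subset_span
  Vθ_le := fun _ => Submodule.le_topologicalClosure _
  Vθ_inv := fun _ _ h => h.elim
  thetaNe_iff := fun _ => ⟨fun _ => mt Submodule.span_singleton_eq_bot.mp hθ, fun _ => trivial⟩
  irr_of_thetaIrr := fun _ _ K hK _ _ => by
    rw [closure_span_singleton] at hK ⊢
    exact eq_bot_or_eq_of_le_span_singleton hθ hK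
  inA10_of_howe := fun _ _ _ => trivial

/-- The junk line dictionary over an EMPTY character type needs no vector at all (every per-character field is
vacuous). -/
def lineOfEmpty (X : Type) [IsEmpty X] : LineDict (ambient : Ambient HG) X where
  G := Smoke.liDatum
  cor55 := Smoke.liDatum_cor55
  n_eq := rfl
  n'_eq := rfl
  d_eq := rfl
  d₀_eq := rfl
  cusp := fun _ => ()
  ds_arch := fun _ _ _ => trivial
  Theta := fun _ => ∅
  Vθ := fun _ => ⊥
  Theta_sub := fun χ => isEmptyElim χ
  Vθ_le := fun χ => isEmptyElim χ
  Vθ_inv := fun χ => isEmptyElim χ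
  thetaNe_iff := fun χ => isEmptyElim χ
  irr_of_thetaIrr := fun χ => isEmptyElim χ
  inA10_of_howe := fun χ => isEmptyElim χ

section Side

variable {H CG G SK SigIdx SigIdxG : Type*}
variable [NormedAddCommGroup H] [InnerProductSpace ℂ H] [CompleteSpace H]
variable [NormedAddCommGroup CG] [NormedSpace ℂ CG]
variable [Group G] [TopologicalSpace G] [TopologicalSpace SK]
variable {C : Perl34.IsolationCore H HG CG G SK SigIdx SigIdxG}

/-- **The junk side dictionary**: both lines junk, and (r3) `allowed_of := ` "every character is allowed" — i.e. the
open input itself. -/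
def side (D : Perl34.TorusData C) (θ : HG) (hθ : θ ≠ 0) (hall : ∀ χ : D.X, D.allowed χ) :
    SideDict (ambient : Ambient HG) D where
  line₁ := line D.X θ hθ
  line₂ := line D.X θ hθ
  allowed_of := fun χ _ _ => hall χ

/-- **ROUTE B's record from the open input** (junk dictionary; occurrence `:= trivial`). -/
def occSide (D : Perl34.TorusData C) (θ : HG) (hθ : θ ≠ 0) (hall : ∀ χ : D.X, D.allowed χ) :
    OccSide (ambient : Ambient HG) D where
  toSideDict := side D θ hθ hall
  occ₁ := fun _ _ _ => trivial
  occ₂ := fun _ _ _ => trivial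

/-- Route B's record over a side WITHOUT characters, from nothing (no vector, no open input). -/
def occSideOfEmpty (D : Perl34.TorusData C) [IsEmpty D.X] : OccSide (ambient : Ambient HG) D where
  line₁ := lineOfEmpty D.X
  line₂ := lineOfEmpty D.X
  allowed_of := fun χ => isEmptyElim χ
  occ₁ := fun χ => isEmptyElim χ
  occ₂ := fun χ => isEmptyElim χ

/-- **ROUTE A's record from the open input**: the junk side dictionary around a UNIT vector `θ` plus the carver's
junk `LocalFactorDatum` (one place, all local factors `1`, `theta := θ`) on both lines; `θ ∈ ℂ∙θ` definitional. -/
def analyticSide (D : Perl34.TorusData C) (θ : HG) (hθ : ‖θ‖ = 1) (hall : ∀ χ : D.X, D.allowed χ) :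
    AnalyticSide (ambient : Ambient HG) D PUnit where
  toSideDict := side D θ (norm_ne_zero_iff.mp (by rw [hθ]; exact one_ne_zero)) hall
  fst := fun _ => LocalFactorDatum.junk θ hθ
  snd := fun _ => LocalFactorDatum.junk θ hθ
  fst_mem := fun _ => Submodule.subset_span rfl
  snd_mem := fun _ => Submodule.subset_span rfl

/-- Route A's record over a side WITHOUT characters, from nothing. -/
def analyticSideOfEmpty (D : Perl34.TorusData C) [IsEmpty D.X] : AnalyticSide (ambient : Ambient HG) D PUnit where
  line₁ := lineOfEmpty D.X
  line₂ := lineOfEmpty D.X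
  allowed_of := fun χ => isEmptyElim χ
  fst := fun χ => isEmptyElim χ
  snd := fun χ => isEmptyElim χ
  fst_mem := fun χ => isEmptyElim χ
  snd_mem := fun χ => isEmptyElim χ

end Side

end Junk

/-! ### Model level: the two records versus `T.Open_chars` -/

section Model

variable {U : Universe} (T : U.ThetaModel)

/-- **Boundary witness, route B.** If every `L²([G_U])` space of the model has a nonzero vector, then route B's
record FOLLOWS from the open input `Open_chars` it is meant to feed (junk dictionary on both sides). -/
theorem printInputs_of_open_chars
    (hNT : ∀ {L : CMField} {ι₁ : L →+* ℂ} (V : HermSpace3 L ι₁), ∃ x : T.HG L ι₁ V, x ≠ 0)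
    (hch : T.Open_chars) : PrintInputs T := by
  intro L ι₁ V c hc
  obtain ⟨x, hx⟩ := hNT V
  exact ⟨Junk.ambient, ⟨Junk.occSide _ x hx fun χ => (hch V c hc).1 χ⟩,
    ⟨Junk.occSide _ x hx fun χ => (hch V c hc).2 χ⟩⟩

/-- **Route B's binder as an equivalence**: modulo a nonzero `L²` vector per surface datum,
`PrintInputs T ↔ T.Open_chars` (→ is pv13-g2's `open_chars_of_print`).  So the record adds no logical strength to
the open input; its value is as the TARGET TYPE of an honest instantiation of the dictionary D2/D4/(r1)/(r3). -/
theorem printInputs_iff_open_chars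
    (hNT : ∀ {L : CMField} {ι₁ : L →+* ℂ} (V : HermSpace3 L ι₁), ∃ x : T.HG L ι₁ V, x ≠ 0) :
    PrintInputs T ↔ T.Open_chars :=
  ⟨open_chars_of_print T, printInputs_of_open_chars T hNT⟩

/-- **Boundary witness, route A.** Under the same hypothesis route A's record follows from `Open_chars` (junk
dictionary + the carver's junk `LocalFactorDatum` around a unit vector). -/
theorem analyticInputs_of_open_chars
    (hNT : ∀ {L : CMField} {ι₁ : L →+* ℂ} (V : HermSpace3 L ι₁), ∃ x : T.HG L ι₁ V, x ≠ 0)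
    (hch : T.Open_chars) : AnalyticInputs T := by
  intro L ι₁ V c hc
  obtain ⟨x, hx⟩ := hNT V
  have hθ : ‖(‖x‖⁻¹ : ℂ) • x‖ = 1 := norm_smul_inv_norm hx
  exact ⟨Junk.ambient, PUnit, ⟨Junk.analyticSide _ _ hθ fun χ => (hch V c hc).1 χ⟩,
    ⟨Junk.analyticSide _ _ hθ fun χ => (hch V c hc).2 χ⟩⟩

/-- **Route A's record as an equivalence** (→ is pv13-g2's `open_chars_of_analytic`). -/
theorem analyticInputs_iff_open_chars
    (hNT : ∀ {L : CMField} {ι₁ : L →+* ℂ} (V : HermSpace3 L ι₁), ∃ x : T.HG L ι₁ V, x ≠ 0) :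
    AnalyticInputs T ↔ T.Open_chars :=
  ⟨open_chars_of_analytic T, analyticInputs_of_open_chars T hNT⟩

/-- Hence, modulo `hNT`, the two routes' records are equivalent to each other (and to `ClusterOutputs T`, by the
carver's `clusterOutputs_iff_open_chars`). -/
theorem printInputs_iff_analyticInputs
    (hNT : ∀ {L : CMField} {ι₁ : L →+* ℂ} (V : HermSpace3 L ι₁), ∃ x : T.HG L ι₁ V, x ≠ 0) :
    PrintInputs T ↔ AnalyticInputs T :=
  (printInputs_iff_open_chars T hNT).trans (analyticInputs_iff_open_chars T hNT).symm

/-! #### The exact price: `hNT` where a character lives, and nothing else -/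

/-- The non-triviality that the records themselves force: in every good context carrying a character of type `w`
or `w'`, `L²([G_U])` has a nonzero vector. -/
def CharsSeeVector : Prop :=
  ∀ {L : CMField} {ι₁ : L →+* ℂ} (V : HermSpace3 L ι₁) (c : SeesawCtx L), T.GoodCtx ι₁ c →
    (Nonempty (T.t12 V c).X ∨ Nonempty (T.t34 V c).X) → ∃ x : T.HG L ι₁ V, x ≠ 0

/-- **Necessity, route B (hypothesis-free):** the record forces a nonzero vector of `V(θ,χ'₁) ⊆ L²([G_U])` for every
character (occurrence ⇒ [Cor 5.5] `V(θ,χ'₁) ≠ 0`). -/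
theorem exists_ne_zero_of_printInputs (h : PrintInputs T) : CharsSeeVector T := by
  intro L ι₁ V c hc hX
  obtain ⟨A, ⟨S12⟩, ⟨S34⟩⟩ := h V c hc
  rcases hX with ⟨⟨χ⟩⟩ | ⟨⟨χ⟩⟩
  · obtain ⟨b, hb, hb0⟩ := Submodule.exists_mem_ne_zero_of_ne_bot
      ((S12.line₁.thetaNe_iff χ).mp (S12.line₁.thetaNe_of_occ χ (S12.occ₁ χ)))
    exact ⟨b, hb0⟩
  · obtain ⟨b, hb, hb0⟩ := Submodule.exists_mem_ne_zero_of_ne_bot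
      ((S34.line₁.thetaNe_iff χ).mp (S34.line₁.thetaNe_of_occ χ (S34.occ₁ χ)))
    exact ⟨b, hb0⟩

/-- **Necessity, route A (hypothesis-free):** the record's local-factor datum carries `θ_φ(χ'₁) ≠ 0` (kernel N31h (i)). -/
theorem exists_ne_zero_of_analyticInputs (h : AnalyticInputs T) : CharsSeeVector T := by
  intro L ι₁ V c hc hX
  obtain ⟨A, Pl, ⟨S12⟩, ⟨S34⟩⟩ := h V c hc
  rcases hX with ⟨⟨χ⟩⟩ | ⟨⟨χ⟩⟩
  · exact ⟨(S12.fst χ).theta, (S12.fst χ).theta_ne_zero⟩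
  · exact ⟨(S34.fst χ).theta, (S34.fst χ).theta_ne_zero⟩

/-- **Route B, exactly:** `PrintInputs T ↔ T.Open_chars ∧ CharsSeeVector T` — no hypothesis. -/
theorem printInputs_iff : PrintInputs T ↔ T.Open_chars ∧ CharsSeeVector T := by
  refine ⟨fun h => ⟨open_chars_of_print T h, exists_ne_zero_of_printInputs T h⟩, fun h => ?_⟩
  obtain ⟨hch, hv⟩ := h
  intro L ι₁ V c hc
  by_cases hX : Nonempty (T.t12 V c).X ∨ Nonempty (T.t34 V c).X
  · obtain ⟨x, hx⟩ := hv V c hc hX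
    exact ⟨Junk.ambient, ⟨Junk.occSide _ x hx fun χ => (hch V c hc).1 χ⟩,
      ⟨Junk.occSide _ x hx fun χ => (hch V c hc).2 χ⟩⟩
  · rw [not_or, not_nonempty_iff, not_nonempty_iff] at hX
    haveI := hX.1
    haveI := hX.2
    exact ⟨Junk.ambient, ⟨Junk.occSideOfEmpty _⟩, ⟨Junk.occSideOfEmpty _⟩⟩

/-- **Route A, exactly:** `AnalyticInputs T ↔ T.Open_chars ∧ CharsSeeVector T` — no hypothesis. -/
theorem analyticInputs_iff : AnalyticInputs T ↔ T.Open_chars ∧ CharsSeeVector T := by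
  refine ⟨fun h => ⟨open_chars_of_analytic T h, exists_ne_zero_of_analyticInputs T h⟩, fun h => ?_⟩
  obtain ⟨hch, hv⟩ := h
  intro L ι₁ V c hc
  by_cases hX : Nonempty (T.t12 V c).X ∨ Nonempty (T.t34 V c).X
  · obtain ⟨x, hx⟩ := hv V c hc hX
    have hθ : ‖(‖x‖⁻¹ : ℂ) • x‖ = 1 := norm_smul_inv_norm hx
    exact ⟨Junk.ambient, PUnit, ⟨Junk.analyticSide _ _ hθ fun χ => (hch V c hc).1 χ⟩,
      ⟨Junk.analyticSide _ _ hθ fun χ => (hch V c hc).2 χ⟩⟩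
  · rw [not_or, not_nonempty_iff, not_nonempty_iff] at hX
    haveI := hX.1
    haveI := hX.2
    exact ⟨Junk.ambient, PUnit, ⟨Junk.analyticSideOfEmpty _⟩, ⟨Junk.analyticSideOfEmpty _⟩⟩

/-- **Seam S3 (the carver's record), hypothesis-free converse:** any N31-cluster output sees a non-zero vector of
`L²([G_U])` as soon as a side has a character — the theta lift `(S.fst χ).theta ≠ 0` (N31h (i), PROVED from the
Rallis identity: `LocalFactorDatum.theta_ne_zero`). -/
theorem exists_ne_zero_of_clusterOutputs (h : ClusterOutputs T) : CharsSeeVector T := by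
  intro L ι₁ V c hc hX
  obtain ⟨Pl, ⟨S12⟩, ⟨S34⟩⟩ := h V c hc
  rcases hX with ⟨⟨χ⟩⟩ | ⟨⟨χ⟩⟩
  · exact ⟨(S12.fst χ).theta, (S12.fst χ).theta_ne_zero⟩
  · exact ⟨(S34.fst χ).theta, (S34.fst χ).theta_ne_zero⟩

/-- **Seam S3, exactly** (completes the carver's `SeamVacuity.clusterOutputs_iff_open_chars (hNT)`):
`ClusterOutputs T ↔ T.Open_chars ∧ CharsSeeVector T` — no hypothesis; so the three N31-side records
`ClusterOutputs T`, `AnalyticInputs T`, `PrintInputs T` are PAIRWISE EQUIVALENT outright (`printInputs_iff`,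
`analyticInputs_iff`), and each is `T.Open_chars` exactly up to the non-triviality clause `CharsSeeVector T`. -/
theorem clusterOutputs_iff : ClusterOutputs T ↔ T.Open_chars ∧ CharsSeeVector T :=
  ⟨fun h => ⟨open_chars_of_cluster T h, exists_ne_zero_of_clusterOutputs T h⟩,
    fun h => clusterOutputs_of_analytic T ((analyticInputs_iff T).2 h)⟩

/-- Hence route A's two records agree outright. -/
theorem clusterOutputs_iff_analyticInputs : ClusterOutputs T ↔ AnalyticInputs T :=
  (clusterOutputs_iff T).trans (analyticInputs_iff T).symm

/-- … and route A's cluster record agrees with route B's print record outright. -/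
theorem clusterOutputs_iff_printInputs : ClusterOutputs T ↔ PrintInputs T :=
  (clusterOutputs_iff T).trans (printInputs_iff T).symm

end Model

end Li92Route
end PerL34
end HodgeCM

end
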